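import Summits.Parity.GeneralizedHardyLittlewood.Theses.PrimeLevelFamEdge
import Literature.NumberTheory.LFunctions.Bettin2017LargeShiftPetersson
import Literature.NumberTheory.LFunctions.KowalskiMichelPeterssonFormulaHolds
import HarnessLib

/-!
# Route `PrimeLevelFamEdge`, support `FirstMomentPrinted` (stmt-Parity-20345) — CLOSED

`FirstMomentPrinted := Literature.NumberTheory.LFunctions.bettin2017_theorem11_primeLevel` (Bettin 2017,
Thm. 1.1 at prime level `N`, weight `2`, trivial twist, no shift: for every `ε > 0`,
`‖Σʰ_{f ∈ S_2(N)^*} λ_f(m) L(½,f) − m^{−1/2}‖ ≤ C m^{1/2} N^{−1+ε}` for all primes `N ≥ N₀` and all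
`m ≥ 1`) is now an UNCONDITIONAL theorem of the tree: the cell landau-siegel / ls-inputs reduced it in
the kernel to Petersson's trace formula at prime level and weight `2`
(`KowalskiMichel2000.kowalskiMichel2000_peterssonFormula`, input I1; line `hecke_afe_petersson`:
exact two-sided central-value formula, Petersson inside the harmonic average, off-diagonal by partial
summation and Weil's bound, dual piece, large shifts without Ramanujan —
`Bettin2017.bettin2017_theorem11_primeLevel_of_petersson`, conditional closer
`firstMomentPrinted_of_peterssonFormula`, p619541), and input I1 is now PROVED
(`KowalskiMichel2000.kowalskiMichel2000_peterssonFormula_holds`, p621287, cell ls-inputs I1, line `poincare-hecke`: Hecke-regularised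
Poincaré series of weight `2`, Selberg's `L²` limit, unfolding, newform Parseval at prime level).

* `FirstMomentPrinted_proof : Theses.PrimeLevelFamEdge.FirstMomentPrinted` — closes stmt-Parity-20345
  (the binder `hF` of the route's deciding theorem `closes`; the twin binder `hP : PeterssonBoundPrinted`,
  stmt-Parity-20404, follows from the same input through `firstMomentPrinted_and_peterssonBoundPrinted_of_peterssonFormula`
  and is closed by the I1 cell).

No other route item is touched; nothing here is a claim about `BeyondDiagonalBeatsQuarter`,
`MomentsBeyondDiagonal`, the fam edge, or Landau–Siegel zeros. «The programme SEARCHES and TYPES; no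
claim about Landau–Siegel zeros, Theorems 1–2 of arXiv:2211.02515 or a repaired Margin232 until a
kernel theorem says so.»
-/

namespace Summit.Parity.GeneralizedHardyLittlewood.Theorems

/-- **Support `FirstMomentPrinted` (stmt-Parity-20345), proved.** Bettin 2017, Thm. 1.1 at prime level
as typed (`bettin2017_theorem11_primeLevel`: `Σʰ λ_f(m)L(½,f) = m^{−1/2} + O_ε(m^{1/2}N^{−1+ε})`, all
`m ≥ 1`, all large primes `N`), from the now-proved Petersson formula at prime level
(`KowalskiMichel2000.kowalskiMichel2000_peterssonFormula_holds`, p621287) through the kernel reduction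
`Bettin2017.bettin2017_theorem11_primeLevel_of_petersson` (the route-side twin `firstMomentPrinted_of_peterssonFormula`, p619541, is the same step). [cite: Bettin2017, Thm. 1.1 (case ν = 1, k = 2, χ = 1, α = 0)]
[cite: KowalskiMichel2000, §2.4.2 p. 312 (Petersson's formula)] -/
theorem FirstMomentPrinted_proof : Theses.PrimeLevelFamEdge.FirstMomentPrinted := by
  unfold Theses.PrimeLevelFamEdge.FirstMomentPrinted
  exact Literature.NumberTheory.LFunctions.Bettin2017.bettin2017_theorem11_primeLevel_of_petersson
    Literature.NumberTheory.LFunctions.KowalskiMichel2000.kowalskiMichel2000_peterssonFormula_holds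

end Summit.Parity.GeneralizedHardyLittlewood.Theorems
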